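import Mathlib.Data.List.Basic
import Mathlib.Data.List.DropRight
import Mathlib.Data.List.Chain
import Mathlib.Data.List.Nodup
import Mathlib.Logic.Equiv.Defs
import HarnessLib

/-!
# Chronological loop erasure of a finite path

Topic `Probability/RandomPlanarGeometry` (discrete input of the loop-erased random walk / uniform
spanning tree theory behind [LSW04] §3–§4 and Schramm (2000)). Pure list combinatorics, no
probability: for a finite sequence of vertices `ω = [ω₀, …, ωₘ]` (a nearest-neighbour path of a
graph, but adjacency plays no role in the definition) Lawler's **chronological loop erasure**
`LE(ω)` is obtained by erasing the loops of `ω` in the order in which they are created: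
`s₀ := max{j : ωⱼ = ω₀}`, `LE(ω)₀ := ω₀`, then `LE(ω)₁ := ω_{s₀+1}`, `s₁ := max{j : ωⱼ = ω_{s₀+1}}`,
and so on until the last vertex `ωₘ` is reached (Lawler, *Intersections of random walks* (1991),
§7.1; Lawler–Limic, *Random walk: a modern introduction* (2010), §11.1; [LSW04] §2.2 "the loop-erasure
of its time-reversal").

We render this by the structural recursion
`loopErase (a :: l) = a :: loopErase (afterLast a l)`, where `afterLast a l` is the part of `l`
strictly after the LAST occurrence of `a` (all of `l` if `a ∉ l`): everything up to the last
visit of the initial vertex is the first erased loop, and the erasure continues from the next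
vertex. Since later vertices of `LE(ω)` are looked for only after `s₀`, this is exactly the
chronological procedure above (and NOT Mathlib's `SimpleGraph.Walk.bypass`, which erases loops
in a different order: on `a b a c b d` it returns `a b d`, chronological erasure returns
`a c b d`).

Main content:

* `afterLast a l`, `throughLast a l` (the complementary prefix, empty or ending in `a`) and the
  splitting `throughLast a l ++ afterLast a l = l`, with its uniqueness
  (`throughLast_append_of`, `afterLast_append_of`) packaged as the bijection `splitLastEquiv a`
  between lists `l` and pairs `(c, r)` with `c = [] ∨ c` ends in `a` and `a ∉ r` — the
  combinatorial core of the "loop decomposition" `{ω : LE(ω) = η}` ≅ (loops at `η₀`) × (loops at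
  `η₁` avoiding `η₀`) × ⋯ behind Lawler's formula for the law of the loop-erased walk;
* `loopErase` and its API: same first and last vertex as `ω` (`head?_loopErase`,
  `getLast_loopErase`), a sublist of `ω` (`loopErase_sublist`), without repetitions
  (`nodup_loopErase`), a chain for any relation `ω` is a chain for (`isChain_loopErase`: loop
  erasure of a nearest-neighbour path is a nearest-neighbour self-avoiding path), fixed on
  repetition-free lists (`loopErase_eq_self`), and compatible with stopping: vertices of `LE(ω)`
  other than the last are non-final vertices of `ω` (`mem_dropLast_of_mem_dropLast_loopErase`), so
  that the erasure of a path stopped on first hitting a set `B` is again such a path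
  (`IsStoppedAt.loopErase`).

## References

* G. F. Lawler, *Intersections of Random Walks*, Birkhäuser (1991), §7.1 (definition of `LE`).
* G. F. Lawler, V. Limic, *Random Walk: A Modern Introduction*, CUP (2010), §11.1.
* G. F. Lawler, O. Schramm, W. Werner, Ann. Probab. 32 (2004) [LawlerSchrammWerner2004], §2.2.
-/

namespace Literature.Probability.RandomPlanarGeometry

section General

variable {V : Type*}

/-! ### List preliminaries -/

/-- `(a :: L).getLast? = L.getLast?` for nonempty `L`. [folklore] -/
theorem getLast?_cons_of_ne_nil (a : V) {L : List V} (h : L ≠ []) :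
    (a :: L).getLast? = L.getLast? := by
  obtain ⟨b, L', rfl⟩ := List.exists_cons_of_ne_nil h
  exact List.getLast?_cons_cons

/-- `(t ++ r).getLast? = r.getLast?` for nonempty `r`. [folklore] -/
theorem getLast?_append_of_ne_nil' (t : List V) {r : List V} (h : r ≠ []) :
    (t ++ r).getLast? = r.getLast? := by
  rw [List.getLast?_eq_some_getLast (List.append_ne_nil_of_right_ne_nil t h),
    List.getLast?_eq_some_getLast h, List.getLast_append_of_ne_nil _ h]

/-- In a list without repetitions, an element of `dropLast` is not the last element. [folklore] -/
theorem ne_getLast_of_mem_dropLast_of_nodup {l : List V} (hl : l.Nodup) {x : V}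
    (hx : x ∈ l.dropLast) (h : l ≠ []) : x ≠ l.getLast h := by
  rw [← List.dropLast_concat_getLast h, List.nodup_append] at hl
  intro heq
  exact hl.2.2 x hx (l.getLast h) (List.mem_singleton_self _) heq

/-! ### Paths stopped on a set -/

/-- A nonempty path is **stopped at `B`** if its last vertex lies in `B` and no earlier vertex
does (the path of a walk run until it first hits `B`). [folklore] -/
def IsStoppedAt (B : Set V) (l : List V) : Prop :=
  ∃ h : l ≠ [], l.getLast h ∈ B ∧ ∀ x ∈ l.dropLast, x ∉ B

/-- A one-vertex path `[b]` with `b ∈ B` is stopped at `B`. [folklore] -/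
theorem isStoppedAt_singleton {B : Set V} {b : V} (hb : b ∈ B) : IsStoppedAt B [b] :=
  ⟨List.cons_ne_nil _ _, by simpa using hb, by simp⟩

/-- Prepending a vertex outside `B` to a path stopped at `B` gives a path stopped at `B`.
[folklore] -/
theorem IsStoppedAt.cons {B : Set V} {l : List V} (h : IsStoppedAt B l) {a : V} (ha : a ∉ B) :
    IsStoppedAt B (a :: l) := by
  obtain ⟨hne, hlast, hdrop⟩ := h
  refine ⟨List.cons_ne_nil _ _, by rwa [List.getLast_cons hne], fun x hx => ?_⟩
  rw [List.dropLast_cons_of_ne_nil hne, List.mem_cons] at hx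
  rcases hx with rfl | hx
  exacts [ha, hdrop x hx]

/-- A path stopped at `B` whose initial vertex lies in `B` is the one-vertex path. [folklore] -/
theorem IsStoppedAt.eq_singleton_of_head_mem {B : Set V} {a : V} {l : List V}
    (h : IsStoppedAt B (a :: l)) (haB : a ∈ B) : l = [] := by
  by_contra hl
  obtain ⟨-, -, hdrop⟩ := h
  refine hdrop a ?_ haB
  rw [List.dropLast_cons_of_ne_nil hl]
  exact List.mem_cons_self

/-- The tail of a path stopped at `B` with at least two vertices is stopped at `B`. [folklore] -/
theorem IsStoppedAt.tail {B : Set V} {a : V} {l : List V} (h : IsStoppedAt B (a :: l))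
    (hl : l ≠ []) : IsStoppedAt B l := by
  obtain ⟨hne, hlast, hdrop⟩ := h
  refine ⟨hl, by rwa [List.getLast_cons hl] at hlast, fun x hx => hdrop x ?_⟩
  rw [List.dropLast_cons_of_ne_nil hl]
  exact List.mem_cons_of_mem a hx

/-- In a path stopped at `B` with at least two vertices the initial vertex is outside `B`.
[folklore] -/
theorem IsStoppedAt.head_not_mem {B : Set V} {a : V} {l : List V} (h : IsStoppedAt B (a :: l))
    (hl : l ≠ []) : a ∉ B :=
  h.2.2 a (by rw [List.dropLast_cons_of_ne_nil hl]; exact List.mem_cons_self)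

/-- The last vertex of a path stopped at `B` lies in `B`. [folklore] -/
theorem IsStoppedAt.getLast_mem {B : Set V} {l : List V} (h : IsStoppedAt B l) :
    l.getLast h.1 ∈ B :=
  h.2.1

/-- The non-final vertices of a path stopped at `B` lie outside `B`. [folklore] -/
theorem IsStoppedAt.not_mem_of_mem_dropLast {B : Set V} {l : List V} (h : IsStoppedAt B l)
    {x : V} (hx : x ∈ l.dropLast) : x ∉ B :=
  h.2.2 x hx

end General

section Erase

variable {V : Type*} [DecidableEq V]

/-! ### Splitting a list at the last occurrence of a vertex -/

/-- `afterLast a l`: the longest suffix of `l` not containing `a`, i.e. the part of `l` strictly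
after the last occurrence of `a` (all of `l` when `a ∉ l`). [folklore] -/
def afterLast (a : V) (l : List V) : List V :=
  l.rtakeWhile fun x => decide (x ≠ a)

/-- `throughLast a l`: the prefix of `l` up to and including the last occurrence of `a`
(empty when `a ∉ l`). [folklore] -/
def throughLast (a : V) (l : List V) : List V :=
  l.rdropWhile fun x => decide (x ≠ a)

/-- The splitting `l = throughLast a l ++ afterLast a l`. [folklore] -/
@[simp] theorem throughLast_append_afterLast (a : V) (l : List V) :
    throughLast a l ++ afterLast a l = l :=
  List.rdropWhile_append_rtakeWhile

/-- `afterLast a l` is a suffix of `l`. [folklore] -/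
theorem afterLast_suffix (a : V) (l : List V) : afterLast a l <:+ l :=
  List.rtakeWhile_suffix _ _

/-- `throughLast a l` is a prefix of `l`. [folklore] -/
theorem throughLast_prefix (a : V) (l : List V) : throughLast a l <+: l :=
  List.rdropWhile_prefix _ _

/-- `afterLast a l` is not longer than `l`. [folklore] -/
theorem length_afterLast_le (a : V) (l : List V) : (afterLast a l).length ≤ l.length :=
  (afterLast_suffix a l).length_le

/-- `a` does not occur after its last occurrence. [folklore] -/
theorem not_mem_afterLast (a : V) (l : List V) : a ∉ afterLast a l := fun h => by
  simpa using List.mem_rtakeWhile_imp h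

/-- `throughLast a l` is empty or ends in `a`. [folklore] -/
theorem throughLast_eq_nil_or_getLast? (a : V) (l : List V) :
    throughLast a l = [] ∨ (throughLast a l).getLast? = some a := by
  by_cases h : throughLast a l = []
  · exact Or.inl h
  · refine Or.inr ?_
    have := List.rdropWhile_last_not (fun x => decide (x ≠ a)) l h
    rw [List.getLast?_eq_some_getLast h]
    simpa [throughLast] using this

/-- `throughLast a l` is empty exactly when `a ∉ l`. [folklore] -/
theorem throughLast_eq_nil_iff {a : V} {l : List V} : throughLast a l = [] ↔ a ∉ l := by
  rw [throughLast, List.rdropWhile_eq_nil_iff]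
  constructor
  · intro h ha
    simpa using h a ha
  · intro h x hx
    have : x ≠ a := fun hxa => h (hxa ▸ hx)
    simpa using this

/-- If `a ∉ l` nothing is split off: `afterLast a l = l`. [folklore] -/
theorem afterLast_eq_self_of_not_mem {a : V} {l : List V} (h : a ∉ l) : afterLast a l = l := by
  have h1 := throughLast_append_afterLast a l
  rwa [throughLast_eq_nil_iff.2 h, List.nil_append] at h1

/-- If `afterLast a l` is empty then `l` is empty or ends in `a`. [folklore] -/
theorem eq_nil_or_getLast?_of_afterLast_eq_nil {a : V} {l : List V} (h : afterLast a l = []) :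
    l = [] ∨ l.getLast? = some a := by
  have hl : throughLast a l = l := by simpa [h] using throughLast_append_afterLast a l
  simpa [hl] using throughLast_eq_nil_or_getLast? a l

/-- `a` occurs in `l` iff it occurs in `throughLast a l`. [folklore] -/
theorem mem_throughLast_iff {a : V} {l : List V} : a ∈ throughLast a l ↔ a ∈ l := by
  constructor
  · exact fun h => (throughLast_prefix a l).subset h
  · intro h
    rcases throughLast_eq_nil_or_getLast? a l with h0 | h0
    · exact absurd h (throughLast_eq_nil_iff.1 h0)
    · exact List.mem_of_getLast? h0

/-- Uniqueness of the splitting, suffix part: if `c` is empty or ends in `a` and `a ∉ r`, then the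
part of `c ++ r` after the last `a` is `r`. [folklore] -/
theorem afterLast_append_of {a : V} {c r : List V} (hc : c = [] ∨ c.getLast? = some a)
    (hr : a ∉ r) : afterLast a (c ++ r) = r := by
  have hr' : ∀ x ∈ r.reverse, decide (x ≠ a) = true := by
    intro x hx
    have : x ≠ a := fun h => hr (by simpa [h] using hx)
    simpa using this
  simp only [afterLast, List.rtakeWhile, List.reverse_append]
  rw [List.takeWhile_append_of_pos hr']
  rcases hc with rfl | hc
  · simp
  · obtain ⟨c', rfl⟩ := List.getLast?_eq_some_iff.1 hc
    simp

/-- Uniqueness of the splitting, prefix part: if `c` is empty or ends in `a` and `a ∉ r`, then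
the part of `c ++ r` through the last `a` is `c`. [folklore] -/
theorem throughLast_append_of {a : V} {c r : List V} (hc : c = [] ∨ c.getLast? = some a)
    (hr : a ∉ r) : throughLast a (c ++ r) = c := by
  have h := throughLast_append_afterLast a (c ++ r)
  rw [afterLast_append_of hc hr] at h
  exact List.append_cancel_right h

/-- **The last-occurrence splitting as a bijection**: `l ↦ (throughLast a l, afterLast a l)`
identifies lists with pairs `(c, r)`, `c` empty or ending in `a`, `a ∉ r`; the inverse is
concatenation. (For walks from `a`: `a :: l ↦` (the loop `a :: c` at `a`, the continuation `r`
avoiding `a`) — the first step of the loop decomposition of `{ω : LE(ω) = η}`.) [folklore] -/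
def splitLastEquiv (a : V) :
    List V ≃ {c : List V // c = [] ∨ c.getLast? = some a} × {r : List V // a ∉ r} where
  toFun l := (⟨throughLast a l, throughLast_eq_nil_or_getLast? a l⟩,
    ⟨afterLast a l, not_mem_afterLast a l⟩)
  invFun p := p.1.1 ++ p.2.1
  left_inv l := throughLast_append_afterLast a l
  right_inv p := by
    obtain ⟨⟨c, hc⟩, ⟨r, hr⟩⟩ := p
    simp only [throughLast_append_of hc hr, afterLast_append_of hc hr]

/-- The inverse of `splitLastEquiv a` is concatenation. [folklore] -/
@[simp] theorem splitLastEquiv_symm_apply (a : V)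
    (p : {c : List V // c = [] ∨ c.getLast? = some a} × {r : List V // a ∉ r}) :
    (splitLastEquiv a).symm p = p.1.1 ++ p.2.1 := rfl

/-- The components of `splitLastEquiv a l`. [folklore] -/
@[simp] theorem splitLastEquiv_apply (a : V) (l : List V) :
    splitLastEquiv a l =
      (⟨throughLast a l, throughLast_eq_nil_or_getLast? a l⟩,
        ⟨afterLast a l, not_mem_afterLast a l⟩) :=
  rfl

/-! ### Chronological loop erasure -/

/-- **Chronological loop erasure** (Lawler): `loopErase [] = []` and
`loopErase (a :: l) = a :: loopErase (afterLast a l)` — erase the loop of `a :: l` at its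
initial vertex `a` (everything through the last visit of `a`), keep `a`, and continue from the
vertex visited next. Equivalently `LE(ω)ᵢ₊₁ = ω_{sᵢ+1}`, `sᵢ = max{j : ωⱼ = LE(ω)ᵢ}`.
[cite: LawlerSchrammWerner2004, §2.2] -/
def loopErase : List V → List V
  | [] => []
  | a :: l => a :: loopErase (afterLast a l)
termination_by l => l.length
decreasing_by exact Nat.lt_succ_of_le (length_afterLast_le a l)

/-- Loop erasure of the empty path. [folklore] -/
@[simp] theorem loopErase_nil : loopErase ([] : List V) = [] := by
  rw [loopErase]

/-- The defining recursion of chronological loop erasure. [folklore] -/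
theorem loopErase_cons (a : V) (l : List V) :
    loopErase (a :: l) = a :: loopErase (afterLast a l) := by
  rw [loopErase]

/-- Loop erasure of a one-vertex path. [folklore] -/
@[simp] theorem loopErase_singleton (a : V) : loopErase [a] = [a] := by
  rw [loopErase_cons]
  simp [afterLast]

/-- `loopErase ω = []` iff `ω = []`. [folklore] -/
@[simp] theorem loopErase_eq_nil_iff {l : List V} : loopErase l = [] ↔ l = [] := by
  cases l with
  | nil => simp
  | cons a l => simp [loopErase_cons]

/-- Loop erasure of a nonempty path is nonempty. [folklore] -/
theorem loopErase_ne_nil {l : List V} (h : l ≠ []) : loopErase l ≠ [] := by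
  simpa using h

/-- Loop erasure keeps the initial vertex. [folklore] -/
@[simp] theorem head?_loopErase (l : List V) : (loopErase l).head? = l.head? := by
  cases l with
  | nil => simp
  | cons a l => simp [loopErase_cons]

/-- Loop erasure keeps the initial vertex (`head` form). [folklore] -/
theorem head_loopErase {l : List V} (h : loopErase l ≠ []) (h' : l ≠ []) :
    (loopErase l).head h = l.head h' := by
  apply Option.some.inj
  rw [← List.head?_eq_some_head h, ← List.head?_eq_some_head h', head?_loopErase]

/-- `LE(ω)` is a sublist of `ω` (its vertices occur in `ω`, in the same order). [folklore] -/
theorem loopErase_sublist : ∀ l : List V, List.Sublist (loopErase l) l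
  | [] => by simp
  | a :: l => by
    rw [loopErase_cons]
    exact ((loopErase_sublist (afterLast a l)).trans (afterLast_suffix a l).sublist).cons_cons a
termination_by l => l.length
decreasing_by exact Nat.lt_succ_of_le (length_afterLast_le a l)

/-- The vertices of `LE(ω)` are vertices of `ω`. [folklore] -/
theorem loopErase_subset (l : List V) : loopErase l ⊆ l :=
  (loopErase_sublist l).subset

/-- `LE(ω)` is not longer than `ω`. [folklore] -/
theorem length_loopErase_le (l : List V) : (loopErase l).length ≤ l.length :=
  (loopErase_sublist l).length_le

/-- **`LE(ω)` is self-avoiding**: it has no repeated vertex. [cite: LawlerSchrammWerner2004, §2.2] -/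
theorem nodup_loopErase : ∀ l : List V, (loopErase l).Nodup
  | [] => by simp
  | a :: l => by
    rw [loopErase_cons, List.nodup_cons]
    exact ⟨fun h => not_mem_afterLast a l (loopErase_subset _ h), nodup_loopErase (afterLast a l)⟩
termination_by l => l.length
decreasing_by exact Nat.lt_succ_of_le (length_afterLast_le a l)

/-- Loop erasure keeps the final vertex. [folklore] -/
theorem getLast?_loopErase : ∀ l : List V, (loopErase l).getLast? = l.getLast?
  | [] => by simp
  | a :: l => by
    rw [loopErase_cons]
    by_cases h : afterLast a l = []
    · -- the whole of `l` is erased: `l` is empty or ends in `a`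
      rw [h, loopErase_nil]
      rcases eq_nil_or_getLast?_of_afterLast_eq_nil h with rfl | hl
      · rfl
      · simp [List.getLast?_cons, hl]
    · have hl : l ≠ [] := by rintro rfl; simp [afterLast] at h
      obtain ⟨t, ht⟩ := afterLast_suffix a l
      have h1 : l.getLast? = (afterLast a l).getLast? := by
        conv_lhs => rw [← ht]
        exact getLast?_append_of_ne_nil' t h
      rw [getLast?_cons_of_ne_nil a (loopErase_ne_nil h), getLast?_loopErase (afterLast a l),
        getLast?_cons_of_ne_nil a hl, h1]
termination_by l => l.length
decreasing_by exact Nat.lt_succ_of_le (length_afterLast_le a l)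

/-- Loop erasure keeps the final vertex (`getLast` form). [folklore] -/
theorem getLast_loopErase {l : List V} (h : loopErase l ≠ []) (h' : l ≠ []) :
    (loopErase l).getLast h = l.getLast h' := by
  apply Option.some.inj
  rw [← List.getLast?_eq_some_getLast h, ← List.getLast?_eq_some_getLast h', getLast?_loopErase]

/-- The vertex following the erased initial loop is adjacent (in `ω`) to the initial vertex: if
`a :: l` is an `R`-chain and `afterLast a l ≠ []`, then `R a (afterLast a l).head`. [folklore] -/
theorem rel_head_afterLast {R : V → V → Prop} {a : V} {l : List V} (h : List.IsChain R (a :: l))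
    (hne : afterLast a l ≠ []) : R a ((afterLast a l).head hne) := by
  have hsplit : a :: l = (a :: throughLast a l) ++ afterLast a l := by
    rw [List.cons_append, throughLast_append_afterLast]
  rw [hsplit] at h
  have key := h.rel_getLast_head_of_append (List.cons_ne_nil _ _) hne
  have hlast : (a :: throughLast a l).getLast (List.cons_ne_nil _ _) = a := by
    rcases throughLast_eq_nil_or_getLast? a l with h0 | h0
    · simp [h0]
    · have hne' : throughLast a l ≠ [] := by rintro h1; simp [h1] at h0
      rw [List.getLast_cons hne']
      exact Option.some.inj (by rw [← List.getLast?_eq_some_getLast hne', h0])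
  rwa [hlast] at key

/-- **Loop erasure of a nearest-neighbour path is a nearest-neighbour path**: if consecutive
vertices of `ω` are `R`-related, so are consecutive vertices of `LE(ω)` (each step of `LE(ω)` is
the step of `ω` out of the last visit of a vertex). [cite: LawlerSchrammWerner2004, §2.2] -/
theorem isChain_loopErase {R : V → V → Prop} : ∀ {l : List V}, List.IsChain R l →
    List.IsChain R (loopErase l)
  | [], _ => by simp
  | a :: l, h => by
    rw [loopErase_cons]
    have hr : List.IsChain R (afterLast a l) := h.tail.suffix (afterLast_suffix a l)
    by_cases hne : afterLast a l = []
    · rw [hne, loopErase_nil]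
      exact List.IsChain.singleton a
    · refine List.IsChain.cons_of_ne_nil (loopErase_ne_nil hne) (isChain_loopErase hr) ?_
      rw [head_loopErase (loopErase_ne_nil hne) hne]
      exact rel_head_afterLast h hne
termination_by l => l.length
decreasing_by exact Nat.lt_succ_of_le (length_afterLast_le a l)

/-- A path without repeated vertices is its own loop erasure. [folklore] -/
theorem loopErase_eq_self : ∀ {l : List V}, l.Nodup → loopErase l = l
  | [], _ => by simp
  | a :: l, h => by
    rw [List.nodup_cons] at h
    rw [loopErase_cons, afterLast_eq_self_of_not_mem h.1, loopErase_eq_self h.2]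

/-- Loop erasure is idempotent. [folklore] -/
@[simp] theorem loopErase_loopErase (l : List V) : loopErase (loopErase l) = loopErase l :=
  loopErase_eq_self (nodup_loopErase l)

/-- Chronological order matters: on `0 1 0 2 1 3` the loop `0 1 0` is erased first and the later
return to `1` is NOT a loop of the erased path, so `LE = 0 2 1 3` (erasing the loop `1 0 2 1`
instead would give `0 1 3`, which is what `SimpleGraph.Walk.bypass` does). [folklore] -/
example : loopErase [0, 1, 0, 2, 1, 3] = [0, 2, 1, 3] := by
  simp [loopErase, afterLast, List.rtakeWhile]

/-! ### Compatibility with stopping -/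

/-- **Non-final vertices of `LE(ω)` are non-final vertices of `ω`.** [folklore] -/
theorem mem_dropLast_of_mem_dropLast_loopErase {l : List V} {x : V}
    (hx : x ∈ (loopErase l).dropLast) : x ∈ l.dropLast := by
  have hne : loopErase l ≠ [] := by rintro h; simp [h] at hx
  have hne' : l ≠ [] := by simpa using hne
  have hx' : x ≠ (loopErase l).getLast hne :=
    ne_getLast_of_mem_dropLast_of_nodup (nodup_loopErase l) hx hne
  rw [getLast_loopErase hne hne'] at hx'
  exact List.mem_dropLast_of_mem_of_ne_getLast (loopErase_subset l (List.dropLast_subset _ hx)) hx'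

/-- **Loop erasure of a path stopped at `B` is stopped at `B`** (same last vertex, non-final
vertices are non-final vertices of the original path): the loop erasure of a walk run until it
hits `B` is a self-avoiding path from the same starting point to the same point of `B`.
[cite: LawlerSchrammWerner2004, §2.2] -/
theorem IsStoppedAt.loopErase {B : Set V} {l : List V} (h : IsStoppedAt B l) :
    IsStoppedAt B (loopErase l) := by
  obtain ⟨hne, hlast, hdrop⟩ := h
  refine ⟨loopErase_ne_nil hne, ?_,
    fun x hx => hdrop x (mem_dropLast_of_mem_dropLast_loopErase hx)⟩
  rwa [getLast_loopErase (loopErase_ne_nil hne) hne]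

end Erase

end Literature.Probability.RandomPlanarGeometry
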